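import Literature.MathematicalPhysics.QuantumFieldTheory.Balaban1983to89.B12B0LoopGeometry267
import HarnessLib

/-!
# S2β · AVG₂♭-ax_q route, brick (P′) part 1 — THE WORD COUNTS OF THE ONE-STEP (0.4) AVERAGE IN `ℓ¹`:
# (run) `Σ_c Σ_i S_run(c,i)[g] = (d!)²·L·Σ_b g b` EXACTLY (i.e. `|I|⁻¹·Σ_c Σ_i S_run = L^{1−d}·Σ_b g b`), (stair) `Σ_y Σ_i S_Γ(y,i)[g] ≤ |I|·(d+2)L·Σ_b g b`,
# and the bond∕site `ℓ¹` letters — the combinatorial half of the `ℓ¹ → ℓ¹` bootstrap of `DΨ_k` (sequel: `…S2BetaChartReadDerivKStepEllOne`)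

Cell `ym3-torus` (YM ladder rung R3 = continuum `SU(2)` Yang–Mills on the three-torus at fixed lattice data — a RUNG: NOT d = 4, NOT infinite volume,
NOT a mass gap, NOT Clay).  Width seat «width 20» `ym3-torus-px20` (gen 23), FREE px helper on crux `stmt-QuantumFields-20520`
(`…Theses.UnitScaleTilt.FluctuationComparisonRegPrIntL`), LINE g18-1 S2β, pairing lane; AVG₂♭-ax_q ⟸ `hLoc` (px16 g22 ⧗`…S2BetaTaylorOfLocal`) needs the k-step derivative
`DΨ_k(0) = DMq` in a norm WITHOUT the `L^k` of ✓p826096 (D2) (sup → sup); in `ℓ¹` over bonds the one-step linearised average `Q₁^{R₀}` splits (✓F1 `…ChartReadDerivStructure`) into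
the LINE MEAN — whose `ℓ¹ → ℓ¹` norm is EXACTLY `L^{1−d}` by the run count of this file —, the coarse covariant gradient of the STAIR MEAN — carried by restriction — and `O(α)`.
`--kind proof --supports stmt-QuantumFields-20520 --as helper`, count-neutral, DEFINITION-FREE (0 `def`, 0 `instance`, 0 `notation`, 0 `sorry`), default heartbeats;
generic `P : Params`, standing range `j + 1 ≤ m + K` where blocks are used; `g : PBond P j → ℝ` an arbitrary (for the stair count: non-negative) weight.

WHAT IS PROVED (sorry-free).
* §1 bond∕site letters: `sum_bond_eq_sum_site_dir` (`Σ_{b} f b = Σ_x Σ_μ f ⟨x, μ⟩`), `sum_site_shift` (`Σ_x f (x + e_μ) = Σ_x f x`), `sum_site_shiftN`, ★`sum_bond_src` ∕ ★`sum_bond_tgt`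
  (`Σ_b F b₋ = d·Σ_x F x = Σ_b F b₊`), ★`sum_emb_le` (`F ≥ 0 ⟹ Σ_y F (emb y) ≤ Σ_x F x`), ★`sum_site_eq_sum_blockSite` (`Σ_x f x = Σ_y Σ_r f (blockSite y r)` — the blocks partition the
  torus, lit ✓`Site.blockEquiv`), `sum_idx_const_perm` (`Σ_{i : Idx} F i.1 = (d!)²·Σ_r F r`).
* §2 ★`sum_map_walk_replicate_true` (`Σ_{s ∈ [x, x + m e_μ]} g s.bond = Σ_{t<m} g ⟨x + t e_μ, μ⟩`), ★★★`sum_runSums_eq` — **THE RUN COUNT**: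
  `Σ_{c : PBond P (j+1)} Σ_{i : Idx P} Σ_{s ∈ walk (walkEnd (emb c₋) Γ^{σ_i}) [L steps +e_{c.dir}]} g s.bond = (d!)²·L·Σ_{b : PBond P j} g b` for EVERY `g` (each fine bond lies on
  exactly `L` of the `L^d` lines of its direction per block-offset family; lit ✓`walkEnd_emb_stairWord_eq_blockSite`, ✓`mem_walk_replicate_true`∕`walk_replicate_true_succ`).
* §3 ★★`sum_stairSums_le` — **THE (BLOCK-TRIVIAL) STAIR COUNT**: for `g ≥ 0`, `Σ_{y} Σ_{i} Σ_{s ∈ walk (emb y) Γ^{σ_i}_{(off r_i)}} g s.bond ≤ |I|·((d+2)L)·Σ_b g b` (a staircase has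
  `≤ (d+2)L` steps, all inside `B(y)` — lit ✓`length_walk_stairWord_le`, ✓`stair_src_tgt_blockOf`; the blocks partition), in both index slots `σ_i`, `σ′_i`, and the
  coarse-bond-indexed forms `sum_stairSums_src_le` ∕ `sum_stairSums_tgt_le` (`Σ_c …(emb c₋)… ≤ d·|I|·(d+2)L·Σ_b g b`, same with `c₊`).

HONEST SCOPE.  Finite combinatorics of the tree's own words (translations, block parametrisation, lengths); no group, no analysis; nothing of Bałaban's is asserted or proved;
the SHARP stair count (`(L^d − 1)∕(2L^d)` per index, this seat's GUIDANCE `compute/colsum.py`) is NOT here and NOT needed by the sequel; `hLoc`, AVG₂♭-ax_q, «MULT♭-ax»∕«CRIT-ax»,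
(D-ax), GAP♯∘ (`stub_uniformFibreGapOrbit`; registry UNTOUCHED), the five REGISTERED stubs, S2β, crux 20520, 19936, 19200 and `YM3TorusSU2` are NOT proved; no summit statement
is proved by a helper; rung R3 = SU(2) YM₃ on T³ at fixed lattice data — NOT d = 4, NOT infinite volume, NOT a mass gap, NOT Clay; the Yang–Mills mass gap is NOT proved.
Axioms standard.

References: T. Bałaban, CMP **109** (1987) 249–301 [Balaban1987RG1] ((0.1), (0.3)–(0.4) pp.251–253: blocks, staircases, the straight segment); CMP **98** (1985) 17–51
[Balaban1985Averaging] ((9) p.19, (124)–(126) p.36).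
-/

set_option autoImplicit false

noncomputable section

open scoped BigOperators

namespace Summit.QuantumFields.YangMills.Theorems.FluctuationComparisonRegPrIntLS2BetaAveragingWordCounts

open Literature.MathematicalPhysics.QuantumFieldTheory.Balaban1983to89
open Literature.MathematicalPhysics.QuantumFieldTheory.Balaban1983to89.T4Continuum
open Literature.MathematicalPhysics.QuantumFieldTheory.Balaban1983to89.BlockAveraging
open Literature.MathematicalPhysics.QuantumFieldTheory.Balaban1983to89.B10Eq47AxialChi (shiftN shiftN_zero shiftN_succ)
open Literature.MathematicalPhysics.QuantumFieldTheory.Balaban1983to89.BlockAveragingEMLLinearised (walkEnd_emb_stairWord_eq_blockSite length_walk_stairWord_le)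
open Literature.MathematicalPhysics.QuantumFieldTheory.Balaban1983to89.B12B0LoopGeometry267 (mem_walk_replicate_true walk_replicate_true_succ stair_src_tgt_blockOf)

variable {P : Params} {j : ℕ}

/-! ## §1 Bond∕site letters: bonds are (site, direction) pairs; translations and the block parametrisation are bijections -/

section Letters

variable {M : Type*} [AddCommMonoid M]

/-- `Σ_{b : PBond} f b = Σ_x Σ_μ f ⟨x, μ⟩` (the bond type IS `Site × Fin d`). [folklore] -/
theorem sum_bond_eq_sum_site_dir {k : ℕ} (f : PBond P k → M) :
    ∑ b : PBond P k, f b = ∑ x : Site P k, ∑ μ : Fin P.d, f ⟨x, μ⟩ := by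
  rw [← Fintype.sum_prod_type']
  let e : Site P k × Fin P.d ≃ PBond P k :=
    { toFun := fun p => ⟨p.1, p.2⟩, invFun := fun b => (b.src, b.dir), left_inv := fun _ => rfl, right_inv := fun _ => rfl }
  exact (Fintype.sum_equiv e (fun p => f ⟨p.1, p.2⟩) f fun _ => rfl).symm

/-- Translation by `e_μ` is a bijection of the torus: `Σ_x f (x + e_μ) = Σ_x f x`. [folklore] -/
theorem sum_site_shift {k : ℕ} (f : Site P k → M) (μ : Fin P.d) :
    ∑ x : Site P k, f (x.shift μ) = ∑ x : Site P k, f x := by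
  have h1 : ∀ x : Site P k, (x.shift μ).unshift μ = x := fun x => T4ReflectionCone.shift_unshift x μ
  have h2 : ∀ x : Site P k, (x.unshift μ).shift μ = x := by
    intro x; funext κ
    simp only [Site.shift, Site.unshift, Function.update_apply]
    split_ifs with h
    · subst h; simp
    · rfl
  let e : Site P k ≃ Site P k := { toFun := fun x => x.shift μ, invFun := fun x => x.unshift μ, left_inv := h1, right_inv := h2 }
  exact Fintype.sum_equiv e (fun x => f (x.shift μ)) f fun _ => rfl

/-- `Σ_x f (x + t e_μ) = Σ_x f x`. [folklore] -/
theorem sum_site_shiftN {k : ℕ} (μ : Fin P.d) : ∀ (t : ℕ) (f : Site P k → M), ∑ x : Site P k, f (shiftN x μ t) = ∑ x : Site P k, f x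
  | 0, f => by simp only [shiftN_zero]
  | t + 1, f => by
    have h := sum_site_shiftN μ t (fun x => f (x.shift μ))
    simp only [shiftN_succ]
    rw [h, sum_site_shift]

/-- ★ `Σ_b F b₋ = d • Σ_x F x`: every site is the initial point of exactly `d` bonds. [folklore] -/
theorem sum_bond_src {k : ℕ} (F : Site P k → M) :
    ∑ b : PBond P k, F b.src = P.d • ∑ x : Site P k, F x := by
  rw [sum_bond_eq_sum_site_dir, Finset.smul_sum]
  refine Finset.sum_congr rfl fun x _ => ?_
  simp only [Finset.sum_const, Finset.card_univ, Fintype.card_fin]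

/-- ★ `Σ_b F b₊ = d • Σ_x F x`: every site is the final point of exactly `d` bonds. [folklore] -/
theorem sum_bond_tgt {k : ℕ} (F : Site P k → M) :
    ∑ b : PBond P k, F b.tgt = P.d • ∑ x : Site P k, F x := by
  rw [sum_bond_eq_sum_site_dir, Finset.sum_comm]
  have h : ∀ μ : Fin P.d, ∑ x : Site P k, F (PBond.tgt ⟨x, μ⟩) = ∑ x : Site P k, F x := fun μ => sum_site_shift F μ
  simp only [h, Finset.sum_const, Finset.card_univ, Fintype.card_fin]

/-- ★ THE BLOCKS PARTITION THE TORUS: `Σ_x f x = Σ_y Σ_r f (blockSite y r)` (standing range; lit `Site.blockEquiv`). [cite: Balaban1987RG1, (0.3) p.252] -/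
theorem sum_site_eq_sum_blockSite (hj : j + 1 ≤ P.m + P.K) (f : Site P j → M) :
    ∑ x : Site P j, f x = ∑ y : Site P (j + 1), ∑ r : Fin P.d → Fin P.L, f (Site.blockSite y r) := by
  classical
  rw [← Fintype.sum_prod_type']
  -- `Site P j ≃ Σ y, {x // blockOf x = y} ≃ Σ y, (Fin d → Fin L) ≃ Site P (j+1) × (Fin d → Fin L)`
  let e : Site P (j + 1) × (Fin P.d → Fin P.L) ≃ Site P j :=
    ((Equiv.sigmaEquivProd (Site P (j + 1)) (Fin P.d → Fin P.L)).symm.trans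
      ((Equiv.sigmaCongrRight fun y => (Site.blockEquiv hj y).symm).trans (Equiv.sigmaFiberEquiv fun x : Site P j => blockOf x)))
  exact (Fintype.sum_equiv e _ _ fun _ => rfl).symm

/-- `Σ_y F (emb y) ≤ Σ_x F x` for `F ≥ 0` (the inclusion of the coarse lattice is injective, standing range). [cite: Balaban1987RG1, (0.1) p.252] -/
theorem sum_emb_le (hj : j + 1 ≤ P.m + P.K) (F : Site P j → ℝ) (hF : ∀ x, 0 ≤ F x) :
    ∑ y : Site P (j + 1), F (emb y) ≤ ∑ x : Site P j, F x := by
  classical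
  have hinj : Function.Injective (emb : Site P (j + 1) → Site P j) :=
    Function.LeftInverse.injective fun y => Site.blockOf_emb hj y
  rw [← Finset.sum_image (f := F) fun y _ y' _ h => hinj h]
  exact Finset.sum_le_univ_sum_of_nonneg hF

/-- `Σ_{i : Idx P} F i.1 = (d!)² • Σ_r F r` (the two orderings are free). [cite: Balaban1987RG1, (0.4) p.253 (bookkeeping)] -/
theorem sum_idx_const_perm (F : (Fin P.d → Fin P.L) → M) :
    ∑ i : Idx P, F i.1 = (Fintype.card (Equiv.Perm (Fin P.d)) * Fintype.card (Equiv.Perm (Fin P.d))) • ∑ r : Fin P.d → Fin P.L, F r := by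
  rw [Fintype.sum_prod_type, Finset.smul_sum]
  refine Finset.sum_congr rfl fun r _ => ?_
  rw [Fintype.sum_prod_type]
  simp only [Finset.sum_const, Finset.card_univ, smul_smul]

end Letters

/-! ## §2 The run count: every fine bond lies on exactly `L` of the straight segments, per ordering pair -/

section Run

/-- ★ **THE UNSIGNED SUM ALONG A STRAIGHT RUN**: `Σ_{s ∈ walk x (m × (+e_μ))} g s.bond = Σ_{t<m} g ⟨x + t e_μ, μ⟩`. [cite: Balaban1985Averaging, (9) p.19] -/
theorem sum_map_walk_replicate_true (g : PBond P j → ℝ) (x : Site P j) (μ : Fin P.d) :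
    ∀ m : ℕ, ((walk x (List.replicate m (μ, true))).map fun s => g s.bond).sum = ∑ t ∈ Finset.range m, g ⟨shiftN x μ t, μ⟩
  | 0 => by simp [walk]
  | m + 1 => by
    rw [walk_replicate_true_succ, List.map_append, List.sum_append, sum_map_walk_replicate_true g x μ m, Finset.sum_range_succ]
    simp

/-- ★★★ **THE RUN COUNT**: summed over all coarse bonds and all indices, the straight segments `[x_i, x_i′]` of (0.4) cover every fine bond of their direction exactly `L·(d!)²`
times: `Σ_c Σ_i Σ_{s ∈ [x_i,x_i′]} g s.bond = (d!)²·L·Σ_b g b` for EVERY weight `g` (standing range). [cite: Balaban1987RG1, (0.3)-(0.4) pp.252-253] -/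
theorem sum_runSums_eq (hj : j + 1 ≤ P.m + P.K) (g : PBond P j → ℝ) :
    ∑ c : PBond P (j + 1), ∑ i : Idx P, ((walk (walkEnd (emb c.src) (stairWord i.2.1 (off i.1))) (List.replicate P.L (c.dir, true))).map fun s => g s.bond).sum =
      ((Fintype.card (Equiv.Perm (Fin P.d)) * Fintype.card (Equiv.Perm (Fin P.d)) : ℕ) : ℝ) * (P.L : ℝ) * ∑ b : PBond P j, g b := by
  classical
  -- the run from `x_i = blockSite c₋ r_i` reads `g` at `⟨x_i + t e_μ, μ⟩`, `t < L`
  have h1 : ∀ (c : PBond P (j + 1)) (i : Idx P),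
      ((walk (walkEnd (emb c.src) (stairWord i.2.1 (off i.1))) (List.replicate P.L (c.dir, true))).map fun s => g s.bond).sum =
        ∑ t ∈ Finset.range P.L, g ⟨shiftN (Site.blockSite c.src i.1) c.dir t, c.dir⟩ := by
    intro c i
    rw [walkEnd_emb_stairWord_eq_blockSite, sum_map_walk_replicate_true]
  simp_rw [h1]
  -- the orderings are free
  have h2 : ∀ c : PBond P (j + 1), ∑ i : Idx P, ∑ t ∈ Finset.range P.L, g ⟨shiftN (Site.blockSite c.src i.1) c.dir t, c.dir⟩ =
      (Fintype.card (Equiv.Perm (Fin P.d)) * Fintype.card (Equiv.Perm (Fin P.d))) •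
        ∑ r : Fin P.d → Fin P.L, ∑ t ∈ Finset.range P.L, g ⟨shiftN (Site.blockSite c.src r) c.dir t, c.dir⟩ :=
    fun c => sum_idx_const_perm (fun r => ∑ t ∈ Finset.range P.L, g ⟨shiftN (Site.blockSite c.src r) c.dir t, c.dir⟩)
  simp_rw [h2]
  rw [← Finset.smul_sum, sum_bond_eq_sum_site_dir]
  -- `Σ_y Σ_μ Σ_r Σ_t = Σ_μ Σ_t Σ_y Σ_r`, blocks partition, translate
  have h3 : ∑ y : Site P (j + 1), ∑ μ : Fin P.d, ∑ r : Fin P.d → Fin P.L, ∑ t ∈ Finset.range P.L, g ⟨shiftN (Site.blockSite y r) μ t, μ⟩ =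
      ∑ μ : Fin P.d, ∑ t ∈ Finset.range P.L, ∑ x : Site P j, g ⟨x, μ⟩ := by
    rw [Finset.sum_comm]
    refine Finset.sum_congr rfl fun μ _ => ?_
    have h4 : ∑ y : Site P (j + 1), ∑ r : Fin P.d → Fin P.L, ∑ t ∈ Finset.range P.L, g ⟨shiftN (Site.blockSite y r) μ t, μ⟩ =
        ∑ x : Site P j, ∑ t ∈ Finset.range P.L, g ⟨shiftN x μ t, μ⟩ :=
      (sum_site_eq_sum_blockSite hj (fun x => ∑ t ∈ Finset.range P.L, g ⟨shiftN x μ t, μ⟩)).symm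
    rw [h4, Finset.sum_comm]
    exact Finset.sum_congr rfl fun t _ => sum_site_shiftN μ t (fun x => g ⟨x, μ⟩)
  rw [h3]
  have h5 : ∑ μ : Fin P.d, ∑ t ∈ Finset.range P.L, ∑ x : Site P j, g ⟨x, μ⟩ = (P.L : ℝ) * ∑ b : PBond P j, g b := by
    simp only [Finset.sum_const, Finset.card_range, nsmul_eq_mul]
    rw [← Finset.mul_sum, sum_bond_eq_sum_site_dir, Finset.sum_comm]
  rw [h5, nsmul_eq_mul]
  ring

end Run

/-! ## §3 The stair count (block-trivial edition): a staircase has at most `(d+2)L` steps, all inside its block -/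

section Stair

/-- The unsigned sum along a walk whose bonds all issue from `B(y)` is at most its length times the block sum. [folklore] -/
theorem sum_map_le_length_mul_blockSum {g : PBond P j → ℝ} (hg : ∀ b, 0 ≤ g b) (y : Site P (j + 1)) (γ : List (LStep P j))
    (hγ : ∀ s ∈ γ, blockOf s.bond.src = y) :
    (γ.map fun s => g s.bond).sum ≤ (γ.length : ℝ) * ∑ b ∈ Finset.univ.filter (fun b : PBond P j => blockOf b.src = y), g b := by
  classical
  have hle : ∀ x ∈ γ.map (fun s => g s.bond), x ≤ ∑ b ∈ Finset.univ.filter (fun b : PBond P j => blockOf b.src = y), g b := by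
    intro x hx
    rw [List.mem_map] at hx
    obtain ⟨s, hs, rfl⟩ := hx
    have hmem : s.bond ∈ Finset.univ.filter (fun b : PBond P j => blockOf b.src = y) := by
      rw [Finset.mem_filter]; exact ⟨Finset.mem_univ _, hγ s hs⟩
    exact Finset.single_le_sum (f := g) (fun b _ => hg b) hmem
  have h := List.sum_le_card_nsmul _ _ hle
  rw [List.length_map, nsmul_eq_mul] at h
  exact h

/-- ★★ **THE STAIR COUNT (block-trivial)**: for `g ≥ 0` and ANY ordering slot `τ i` of the index, `Σ_y Σ_i Σ_{s ∈ walk (emb y) Γ^{τ_i}} g s.bond ≤ |I|·((d+2)L)·Σ_b g b`.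
[cite: Balaban1987RG1, (0.3) p.252] -/
theorem sum_stairSums_le (hj : j + 1 ≤ P.m + P.K) {g : PBond P j → ℝ} (hg : ∀ b, 0 ≤ g b) (τ : Idx P → Equiv.Perm (Fin P.d)) :
    ∑ y : Site P (j + 1), ∑ i : Idx P, ((walk (emb y) (stairWord (τ i) (off i.1))).map fun s => g s.bond).sum ≤
      (Fintype.card (Idx P) : ℝ) * (((P.d + 2) * P.L : ℕ) : ℝ) * ∑ b : PBond P j, g b := by
  classical
  have hB0 : ∀ y : Site P (j + 1), 0 ≤ ∑ b ∈ Finset.univ.filter (fun b : PBond P j => blockOf b.src = y), g b :=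
    fun y => Finset.sum_nonneg fun b _ => hg b
  have h1 : ∀ (y : Site P (j + 1)) (i : Idx P), ((walk (emb y) (stairWord (τ i) (off i.1))).map fun s => g s.bond).sum ≤
      (((P.d + 2) * P.L : ℕ) : ℝ) * ∑ b ∈ Finset.univ.filter (fun b : PBond P j => blockOf b.src = y), g b := by
    intro y i
    refine (sum_map_le_length_mul_blockSum hg y _ fun s hs => (stair_src_tgt_blockOf hj y (τ i) i.1 s hs).1).trans ?_
    refine mul_le_mul_of_nonneg_right ?_ (hB0 y)
    exact_mod_cast length_walk_stairWord_le (emb y) (τ i) i.1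
  calc _ ≤ ∑ y : Site P (j + 1), ∑ _i : Idx P, (((P.d + 2) * P.L : ℕ) : ℝ) * ∑ b ∈ Finset.univ.filter (fun b : PBond P j => blockOf b.src = y), g b :=
        Finset.sum_le_sum fun y _ => Finset.sum_le_sum fun i _ => h1 y i
    _ = (Fintype.card (Idx P) : ℝ) * (((P.d + 2) * P.L : ℕ) : ℝ) *
          ∑ y : Site P (j + 1), ∑ b ∈ Finset.univ.filter (fun b : PBond P j => blockOf b.src = y), g b := by
        simp only [Finset.sum_const, Finset.card_univ, nsmul_eq_mul]
        rw [Finset.mul_sum]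
        exact Finset.sum_congr rfl fun y _ => by ring
    _ = (Fintype.card (Idx P) : ℝ) * (((P.d + 2) * P.L : ℕ) : ℝ) * ∑ b : PBond P j, g b := by
        rw [Finset.sum_fiberwise_of_maps_to (g := fun b : PBond P j => blockOf b.src) fun b _ => Finset.mem_univ _]

/-- The stair count indexed by coarse bonds through their initial points: `Σ_c Σ_i S_Γ(c₋, i) ≤ d·|I|·(d+2)L·Σ_b g b`. [cite: Balaban1987RG1, (0.3)-(0.4) pp.252-253] -/
theorem sum_stairSums_src_le (hj : j + 1 ≤ P.m + P.K) {g : PBond P j → ℝ} (hg : ∀ b, 0 ≤ g b) (τ : Idx P → Equiv.Perm (Fin P.d)) :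
    ∑ c : PBond P (j + 1), ∑ i : Idx P, ((walk (emb c.src) (stairWord (τ i) (off i.1))).map fun s => g s.bond).sum ≤
      (P.d : ℝ) * ((Fintype.card (Idx P) : ℝ) * (((P.d + 2) * P.L : ℕ) : ℝ) * ∑ b : PBond P j, g b) := by
  rw [sum_bond_src (F := fun y : Site P (j + 1) => ∑ i : Idx P, ((walk (emb y) (stairWord (τ i) (off i.1))).map fun s => g s.bond).sum), nsmul_eq_mul]
  exact mul_le_mul_of_nonneg_left (sum_stairSums_le hj hg τ) (Nat.cast_nonneg _)

/-- The stair count indexed by coarse bonds through their final points: `Σ_c Σ_i S_Γ(c₊, i) ≤ d·|I|·(d+2)L·Σ_b g b`. [cite: Balaban1987RG1, (0.3)-(0.4) pp.252-253] -/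
theorem sum_stairSums_tgt_le (hj : j + 1 ≤ P.m + P.K) {g : PBond P j → ℝ} (hg : ∀ b, 0 ≤ g b) (τ : Idx P → Equiv.Perm (Fin P.d)) :
    ∑ c : PBond P (j + 1), ∑ i : Idx P, ((walk (emb c.tgt) (stairWord (τ i) (off i.1))).map fun s => g s.bond).sum ≤
      (P.d : ℝ) * ((Fintype.card (Idx P) : ℝ) * (((P.d + 2) * P.L : ℕ) : ℝ) * ∑ b : PBond P j, g b) := by
  rw [sum_bond_tgt (F := fun y : Site P (j + 1) => ∑ i : Idx P, ((walk (emb y) (stairWord (τ i) (off i.1))).map fun s => g s.bond).sum), nsmul_eq_mul]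
  exact mul_le_mul_of_nonneg_left (sum_stairSums_le hj hg τ) (Nat.cast_nonneg _)

end Stair

end Summit.QuantumFields.YangMills.Theorems.FluctuationComparisonRegPrIntLS2BetaAveragingWordCounts

end
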